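import Summits.HodgeConjecture.HodgeConjecture.Theorems.F0P3KitOfRecordClosed              -- ★ p822611 (K1′∕K7 ED. 2): `tokenInf_kitOfRecord`, → ★ K7 `unitaryCoord_kitOfRecord` …, ★ K0 `kitOfRecord`
import Summits.HodgeConjecture.HodgeConjecture.Theorems.F0P3AutomorphicFlathAdmissibleOfCot   -- ★ p822835 (p02 (g7)): `localIsotypyFin₀_of_isCot` — row #22 IN-HOUSE on the cotangent locus
import Summits.HodgeConjecture.HodgeConjecture.Theorems.F0P3ClassificationLawsV8            -- ★ V8-B (p03 (g7)): `…F0P3InnerFormClassificationV8.ClassificationKit.Laws` (21 rows, RULINGS (V43)(V44))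
import Summits.HodgeConjecture.HodgeConjecture.Theorems.F0P3InnerFormClassificationV8      -- ★ V8-D (p03 (g7)): `KitFamily`, `KitFamily.Laws`, `shapeGuarded_of_T5` (v8 head, v4 conclusion text)
import Summits.HodgeConjecture.HodgeConjecture.Theorems.F0P3KitFamilyOfRecord             -- ★ p822799 (K9 interface): `FrameData`, `kitFamilyOfRecord`, `isPinned_kitFamilyOfRecord`
import Summits.HodgeConjecture.HodgeConjecture.Theorems.F0P3GuardedLettersOfGuardedShape  -- ★ p820383 (B0 ED. 2): `letters_of_guardedEngine`
import HarnessLib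

/-!
# K7 ED. 4 ∕ KitFamily ED. 3 ∕ SpecPkg ED. 3 — the v8 `Laws … S₀` AT THE KIT OF RECORD `𝔠₀ = kitOfRecord …` (the BOOKS PASS, RULINGS (V43)(V44))

Cell `hodgecm-mathlib`, F0∕P3 «U3-mult», crux H413 (`stmt-HodgeConjecture-24833`), rung 4; F0P3-p04 (g7), PLAN ERRATUM 6 (2)(5).  PROOF lane: theorems only.

The T5 dossier v8 ((the LEVEL PASS)) deletes rows #11 `ClassEq` and #12 `FlathDet` and GUARDS rows #15 `Routing` ∕ #22 `LocalIsotypyFin` by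
`IsCot P → KcTrivial P →`; its Theorems edition ★ V8-B types the laws over the REDUCIBLE ALIAS `…V8.ClassificationKit := …V6.ClassificationKit`, so the kit of
record `𝔠₀ := kitOfRecord …` (★ K0, V6-typed) IS a v8 kit and every ★ V6 row instance at `𝔠₀` proves the same-named v8 row by `δ` (same law text).
**`laws₈_kitOfRecord_of₄`** = ★ `laws_kitOfRecord_of₂` (K7 ED. 2) re-based: the hypotheses `h12 : FlathDet` and «AFA» `hAF` are GONE — row #22 is the in-house
★ `localIsotypyFin₀_of_isCot` under the guard, row #16 `TokenInf` ★ `tokenInf_kitOfRecord`, rows #9 #17 #18 #19 ★ K7 — and the fourteen remaining hypotheses are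
the v8 law texts at `𝔠₀` (h15 `Routing` in its GUARDED v8 form; an unguarded ★ V6 instance `h` serves as `fun P _ _ => h P`).
References: [Rogawski1990] §14.6 Thm. 14.6.4 pp. 236–244, §13.8 Prop. 13.8.1, §15.3 ¶1; [FlathCorvallis1979] Thm. 3; [BorelWallach2000] VI Thm. 4.11.
HC_CM is proved only modulo the printed citations until rung 0 closes.
-/

attribute [local instance 100] LieRing.ofAssociativeRing

set_option autoImplicit false
set_option linter.dupNamespace false

noncomputable section

open NumberField IsDedekindDomain MeasureTheory
open Literature.NumberTheory.Rogawski1990 Literature.NumberTheory.GaloisRepresentations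
open Literature.NumberTheory.Automorphic Literature.NumberTheory.Automorphic.UnitaryGroup
open Literature.NumberTheory.Automorphic.UnitaryGroup.CotangentForms
open Literature.RepresentationTheory.BorelWallach2000 Literature.RepresentationTheory.KonnoKonno2007
open scoped Matrix ComplexOrder

/-! ## §0 SpecPkg ED. 3 — the witnessed package at level `S₀` (v8 law names; in the alias namespace, so no clash with ★ K9α's v6 `SpecPkg`) -/

namespace Summit.HodgeConjecture.HodgeConjecture.Cruxes.H413.F0P3InnerFormClassificationV8.ClassificationKit

open Summit.HodgeConjecture.HodgeConjecture.Cruxes.H413.F0P3InnerFormClassificationV6 (Places Germ germ)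

variable {L : Type} [Field L] [NumberField L] [IsCMField L] {H : Matrix (Fin 3) (Fin 3) L} {ι : L →+* ℂ} {T : GL (Fin 3) ℂ}
  {hT : (T : Matrix (Fin 3) (Fin 3) ℂ)ᴴ * H.map ι * (T : Matrix (Fin 3) (Fin 3) ℂ) = Literature.Geometry.ComplexHyperbolic.BallModel.J}
  {μ : Measure (F0P3InnerFormClassificationV6.Gp L H).automorphicQuotient} [(F0P3InnerFormClassificationV6.Gp L H).IsAutomorphicMeasure μ]

/-- **The CLASS conjunct of the v8 law (L7) `Factorisation S₀`** — letter TF's content at level `S₀` [FlathCorvallis1979 Thm. 3; Rogawski1990 §13.7 p. 206, §14.5 p. 237]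
(kit predicate, explicit kit binder). -/
def FactorisationCls (𝔠 : ClassificationKit L H ι T hT μ) (S₀ : Finset (Places L)) : Prop :=
  ∀ (S : Finset (Places L)) (c : 𝔠.Cls) (fS : 𝔠.TestS S) (fT : 𝔠.Unr S), S₀ ⊆ S →
    (𝔠.Adm S c → 𝔠.trGp c (𝔠.tens S fS fT) = 𝔠.chS S (𝔠.coordS S c) fS * 𝔠.hat S (germ L H S (𝔠.evp c)) fT) ∧
    (¬ 𝔠.Adm S c → 𝔠.trGp c (𝔠.tens S fS fT) = 0)

/-- **The two PACKET conjuncts of the v8 law (L7) `Factorisation S₀`** [FlathCorvallis1979 Thm. 3; CartierCorvallis1979 §IV; Rogawski1990 §13.2, §13.7 p. 206]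
(kit predicate, explicit kit binder). -/
def FactorisationPk (𝔠 : ClassificationKit L H ι T hT μ) (S₀ : Finset (Places L)) : Prop :=
  (∀ (S : Finset (Places L)) (Q : 𝔠.PacketG) (fSG : 𝔠.TestSG S) (fT : 𝔠.Unr S), S₀ ⊆ S →
      (𝔠.ramG Q ⊆ S → 𝔠.trG Q (𝔠.tensG S fSG fT) = 𝔠.trGS S Q fSG * 𝔠.hat S (germ L H S (𝔠.evpG Q)) fT) ∧
      (¬ 𝔠.ramG Q ⊆ S → 𝔠.trG Q (𝔠.tensG S fSG fT) = 0)) ∧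
  (∀ (S : Finset (Places L)) (ρ : 𝔠.PacketH) (fSH : 𝔠.TestSH S) (fT : 𝔠.Unr S), S₀ ⊆ S →
      (𝔠.ramH ρ ⊆ S → 𝔠.trH ρ (𝔠.tensH S fSH fT) = 𝔠.trHS S ρ fSH * 𝔠.hat S (germ L H S (𝔠.evpH ρ)) fT) ∧
      (¬ 𝔠.ramH ρ ⊆ S → 𝔠.trH ρ (𝔠.tensH S fSH fT) = 0))

variable (𝔠 : ClassificationKit L H ι T hT μ)

/-- v8 `Factorisation S₀` from its class and packet conjuncts. [cite: FlathCorvallis1979, Thm. 3] -/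
theorem factorisation_of_cls_of_pk {S₀ : Finset (Places L)} (hc : 𝔠.FactorisationCls S₀) (hp : 𝔠.FactorisationPk S₀) : 𝔠.Factorisation S₀ :=
  ⟨hc, hp.1, hp.2⟩

/-- **`SpecPkg 𝔠 S₀`** (ED. 3, v8) — the WITNESSED spectral∕packet package at level `S₀`: the five v8 laws that read T1's placeholder sockets
[Rogawski1990 §14.6 Thm. 14.6.1 p. 241, Thm. 14.6.4 p. 244, (14.2.1) p. 232; Flath1979 Thm. 3]. -/
structure SpecPkg (S₀ : Finset (Places L)) : Prop where
  /-- (L7) on the packet sides, level `S₀` -/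
  factorisationPk : 𝔠.FactorisationPk S₀
  /-- matching of factorised triples, level `S₀` -/
  matchingS : 𝔠.MatchingS S₀
  /-- transfer exists at every `f′_S`, level `S₀` -/
  transferS : 𝔠.TransferS S₀
  /-- (L3) A-packet spectral data, level `S₀` -/
  aPacketSpectral : 𝔠.APacketSpectral S₀
  /-- (L6) the local expansion (14.6.3), level `S₀` -/
  localExpansion : 𝔠.LocalExpansion S₀

/-- `SpecPkg` is monotone in the level. -/
theorem SpecPkg.mono {S₀ S₀' : Finset (Places L)} (h : S₀ ⊆ S₀') (hp : 𝔠.SpecPkg S₀) : 𝔠.SpecPkg S₀' :=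
  ⟨⟨fun S Q fSG fT hS => hp.factorisationPk.1 S Q fSG fT (h.trans hS), fun S ρ fSH fT hS => hp.factorisationPk.2 S ρ fSH fT (h.trans hS)⟩,
    hp.matchingS.mono h, hp.transferS.mono h, hp.aPacketSpectral.mono h, hp.localExpansion.mono h⟩

/-- `FactorisationCls` is monotone in the level. -/
theorem FactorisationCls.mono {S₀ S₀' : Finset (Places L)} (h : S₀ ⊆ S₀') (hp : 𝔠.FactorisationCls S₀) : 𝔠.FactorisationCls S₀' :=
  fun S c fS fT hS => hp S c fS fT (h.trans hS)

end Summit.HodgeConjecture.HodgeConjecture.Cruxes.H413.F0P3InnerFormClassificationV8.ClassificationKit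

namespace Summit.HodgeConjecture.HodgeConjecture.Cruxes.H413.F0P3KitOfRecord

open Summit.HodgeConjecture.HodgeConjecture.Cruxes.H413.F0P3InnerFormClassificationV6 (Sockets Gp Places Cinf IsCot KcTrivial)
open Summit.HodgeConjecture.HodgeConjecture.Cruxes.H413.F0P3ClassTokensOfRecord (Cls cl rep mult)
open Summit.HodgeConjecture.HodgeConjecture.Cruxes.H413.F0P3XiArchPacketOfRecord (JInfNoDegOne DsInfNoDegOne)
open Summit.HodgeConjecture.HodgeConjecture.Cruxes.H413.F0P3AutomorphicFlathAdmissibleOfCot (localIsotypyFin₀_of_isCot)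
open Summit.HodgeConjecture.HodgeConjecture.Cruxes.H413.F0P3GuardedLettersOfGuardedShape (letters_of_guardedEngine)

variable (L : Type) [Field L] [NumberField L] [IsCMField L] (H : Matrix (Fin 3) (Fin 3) L) (ι : L →+* ℂ) (T : GL (Fin 3) ℂ)
  (hT : (T : Matrix (Fin 3) (Fin 3) ℂ)ᴴ * H.map ι * (T : Matrix (Fin 3) (Fin 3) ℂ) = Literature.Geometry.ComplexHyperbolic.BallModel.J)
  (μ : Measure (Gp L H).automorphicQuotient) [(Gp L H).IsAutomorphicMeasure μ]
  [MeasurableSpace (Gp L H).Adelic] [BorelSpace (Gp L H).Adelic]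
  (𝔰 : Sockets L H μ) (gh : GHSide L H ι T hT 𝔰.PacketG 𝔰.PacketH) (ξd : XiSide L H 𝔰.PacketG 𝔰.PacketH)
  (μω : HeckeCharacter L) (hμu : μω.IsUnitary) (c : ℚ) (jInf dsInf : ℤ → ℤ → ℤ → Cinf)
  (archTr : Cinf → (UnitaryGroup.arch (↥(maximalRealSubfield L)) L (IsCMField.complexConj L) 3 H → ℂ) → ℂ)
  (ν : Measure (Gp L H).Adelic) [IsFiniteMeasureOnCompacts ν]
  (μv : ∀ v : Places L, @Measure ((cmDatum L 3 H).Local v) (borel _))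
  (ramCls₀' : DiscreteAutomorphicRep (Gp L H) μ → Set (Places L))

/-! ## §1 Row #22 (L7″) at `𝔠₀`, GUARDED form, in-house -/

/-- **Row #22 `LocalIsotypyFin` (v8, guarded) AT `𝔠₀` — IN-HOUSE**: for `P` of cotangent type every local constituent class at `v` is `clFinChoice (rep (cl P)) v`
(★ `localIsotypyFin₀_of_isCot`; the `KcTrivial` guard is not even needed). [cite: FlathCorvallis1979, Thm. 3] [cite: Rogawski1990, §14.5 p. 237] -/
theorem localIsotypyFin₈_kitOfRecord
    (hdef : ∀ τ' : L →+* ℂ, InfinitePlace.mk τ' ≠ InfinitePlace.mk ι → (H.map τ').PosDef) (h2 : 2 ≤ Module.finrank ℚ ↥(maximalRealSubfield L)) :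
    F0P3InnerFormClassificationV8.ClassificationKit.LocalIsotypyFin (kitOfRecord L H ι T hT μ 𝔰 gh ξd μω c jInf dsInf archTr ν μv ramCls₀') :=
  fun P hP _ v c' hc' => localIsotypyFin₀_of_isCot ι T hT hdef h2 P hP v c' hc'

/-! ## §2 The v8 `Laws` at `𝔠₀` from the fourteen remaining rows -/

/-- **K7 ED. 3 — `laws₈_kitOfRecord_of₄`**: the v8 `Laws` (21 rows) of the kit of record from the FOURTEEN hypotheses #1 #2 #3 #4 #5 #6 #7 #8 #10 #13 #14 #15 (v8-guarded)
#20 #21 #23 (all v8 law texts at `𝔠₀`) + the arch clauses `hJ hD` and the `μω`-convention `hμω`; rows #9 #16 #17 #18 #19 #22 are ★ in-house (K7, K1′, p822835).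
No `FlathDet`, no «AFA» (RULINGS (V43)(V44)). [cite: Rogawski1990, §14.6 Thm. 14.6.4 pp. 236–244; §13.8 Prop. 13.8.1; §15.3 ¶1] [cite: BorelWallach2000, VI Thm. 4.11] -/
theorem laws₈_kitOfRecord_of₄ (S₀ : Finset (Places L))
    (hdef : ∀ τ' : L →+* ℂ, InfinitePlace.mk τ' ≠ InfinitePlace.mk ι → (H.map τ').PosDef) (h2 : 2 ≤ Module.finrank ℚ ↥(maximalRealSubfield L))
    (h1 : F0P3InnerFormClassificationV8.ClassificationKit.TraceIdentity (kitOfRecord L H ι T hT μ 𝔰 gh ξd μω c jInf dsInf archTr ν μv ramCls₀'))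
    (h2' : F0P3InnerFormClassificationV8.ClassificationKit.SpectralSideGp (kitOfRecord L H ι T hT μ 𝔰 gh ξd μω c jInf dsInf archTr ν μv ramCls₀'))
    (h3 : F0P3InnerFormClassificationV8.ClassificationKit.Factorisation (kitOfRecord L H ι T hT μ 𝔰 gh ξd μω c jInf dsInf archTr ν μv ramCls₀') S₀)
    (h4 : F0P3InnerFormClassificationV8.ClassificationKit.MatchingS (kitOfRecord L H ι T hT μ 𝔰 gh ξd μω c jInf dsInf archTr ν μv ramCls₀') S₀)
    (h5 : F0P3InnerFormClassificationV8.ClassificationKit.TransferS (kitOfRecord L H ι T hT μ 𝔰 gh ξd μω c jInf dsInf archTr ν μv ramCls₀') S₀)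
    (h6 : F0P3InnerFormClassificationV8.ClassificationKit.HatBounded (kitOfRecord L H ι T hT μ 𝔰 gh ξd μω c jInf dsInf archTr ν μv ramCls₀') S₀)
    (h7 : F0P3InnerFormClassificationV8.ClassificationKit.UnrStarAlgebra (kitOfRecord L H ι T hT μ 𝔰 gh ξd μω c jInf dsInf archTr ν μv ramCls₀') S₀)
    (h8 : F0P3InnerFormClassificationV8.ClassificationKit.LinIndepS (kitOfRecord L H ι T hT μ 𝔰 gh ξd μω c jInf dsInf archTr ν μv ramCls₀'))
    (h10 : F0P3InnerFormClassificationV8.ClassificationKit.UnitaryPacket (kitOfRecord L H ι T hT μ 𝔰 gh ξd μω c jInf dsInf archTr ν μv ramCls₀') S₀)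
    (h13 : F0P3InnerFormClassificationV8.ClassificationKit.APacketSpectral (kitOfRecord L H ι T hT μ 𝔰 gh ξd μω c jInf dsInf archTr ν μv ramCls₀') S₀)
    (h14 : F0P3InnerFormClassificationV8.ClassificationKit.LocalExpansion (kitOfRecord L H ι T hT μ 𝔰 gh ξd μω c jInf dsInf archTr ν μv ramCls₀') S₀)
    (h15 : F0P3InnerFormClassificationV8.ClassificationKit.Routing (kitOfRecord L H ι T hT μ 𝔰 gh ξd μω c jInf dsInf archTr ν μv ramCls₀'))
    (hμω : ∀ x : Literature.NumberTheory.GaloisRepresentations.ideleGroup ↥(maximalRealSubfield L),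
      μω (AdeleRing.ideleBaseChange (↥(maximalRealSubfield L)) L x) = quadraticHeckeCharCM L x)
    (hJ : JInfNoDegOne jInf) (hD : DsInfNoDegOne dsInf)
    (h20 : F0P3InnerFormClassificationV8.ClassificationKit.XiFamilyFin (kitOfRecord L H ι T hT μ 𝔰 gh ξd μω c jInf dsInf archTr ν μv ramCls₀') μω hμu)
    (h21 : F0P3InnerFormClassificationV8.ClassificationKit.XiUnram (kitOfRecord L H ι T hT μ 𝔰 gh ξd μω c jInf dsInf archTr ν μv ramCls₀'))
    (h23 : F0P3InnerFormClassificationV8.ClassificationKit.EvpConvention (kitOfRecord L H ι T hT μ 𝔰 gh ξd μω c jInf dsInf archTr ν μv ramCls₀')) :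
    F0P3InnerFormClassificationV8.ClassificationKit.Laws (kitOfRecord L H ι T hT μ 𝔰 gh ξd μω c jInf dsInf archTr ν μv ramCls₀') μω hμu S₀ where
  traceIdentity := h1
  spectralSideGp := h2'
  factorisation := h3
  matchingS := h4
  transferS := h5
  hatBounded := h6
  unrStarAlgebra := h7
  linIndepS := h8
  unitaryCoord := unitaryCoord_kitOfRecord L H ι T hT μ 𝔰 gh ξd μω c jInf dsInf archTr ν μv ramCls₀'
  unitaryPacket := h10
  aPacketSpectral := h13
  localExpansion := h14
  routing := h15
  tokenInf := tokenInf_kitOfRecord L H ι T hT μ 𝔰 gh ξd μω c jInf dsInf archTr ν μv ramCls₀' hdef h2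
  archPacketCoh := archPacketCoh_kitOfRecord L H ι T hT μ 𝔰 gh ξd μω c jInf dsInf archTr ν μv ramCls₀' hJ hD
  archMember := archMember_kitOfRecord L H ι T hT μ 𝔰 gh ξd μω hμu c jInf dsInf archTr ν μv ramCls₀' hμω hJ hD
  cptXiSpec := cptXiSpec_kitOfRecord L H ι T hT μ 𝔰 gh ξd μω c jInf dsInf archTr ν μv ramCls₀'
  xiFamilyFin := h20
  xiUnram := h21
  localIsotypyFin := localIsotypyFin₈_kitOfRecord L H ι T hT μ 𝔰 gh ξd μω c jInf dsInf archTr ν μv ramCls₀' hdef h2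
  evpConvention := h23

/-- **The same with row #15 `Routing` fed UNGUARDED** (the v6 text at `𝔠₀`, as ★ p823358 `routing_kitOfRecord` concludes it): `fun P _ _ => h P`.
[cite: Rogawski1990, §15.3 ¶1 p. 244; Thm. 13.3.6 (c)] -/
theorem routing₈_kitOfRecord_of_v6
    (h : (kitOfRecord L H ι T hT μ 𝔰 gh ξd μω c jInf dsInf archTr ν μv ramCls₀').Routing) :
    F0P3InnerFormClassificationV8.ClassificationKit.Routing (kitOfRecord L H ι T hT μ 𝔰 gh ξd μω c jInf dsInf archTr ν μv ramCls₀') :=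
  fun P _ _ => h P

/-! ## §3 The family of record: v8 laws frame-wise, and the HJ3a LETTERS via the v8 head -/

section Family

/-- **Family-level v8 `Laws` from frame-wise v8 `Laws`** (★ V8-D `KitFamily.Laws` IS the frame-wise statement; `kitFamilyOfRecord 𝔇` is a v8 family by `rfl`).
[cite: Rogawski1990, §14.6 Thm. 14.6.4] -/
theorem lawsV8_kitFamilyOfRecord_of
    (𝔇 : ∀ (L : Type) [Field L] [NumberField L] [IsCMField L] (ι : L →+* ℂ) (H : Matrix (Fin 3) (Fin 3) L) (T : GL (Fin 3) ℂ)
      (hT : (T : Matrix (Fin 3) (Fin 3) ℂ)ᴴ * H.map ι * (T : Matrix (Fin 3) (Fin 3) ℂ) = Literature.Geometry.ComplexHyperbolic.BallModel.J),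
      (∀ τ' : L →+* ℂ, InfinitePlace.mk τ' ≠ InfinitePlace.mk ι → (H.map τ').PosDef) →
      2 ≤ Module.finrank ℚ ↥(maximalRealSubfield L) →
      ∀ (μ : Measure (Gp L H).automorphicQuotient) [(Gp L H).IsAutomorphicMeasure μ] (μω : HeckeCharacter L) (_hμu : μω.IsUnitary),
      (∀ x : Literature.NumberTheory.GaloisRepresentations.ideleGroup ↥(maximalRealSubfield L),
        μω (AdeleRing.ideleBaseChange (↥(maximalRealSubfield L)) L x) = quadraticHeckeCharCM L x) → FrameData L H ι T hT μ)
    (hL : ∀ (L : Type) [Field L] [NumberField L] [IsCMField L] (ι : L →+* ℂ) (H : Matrix (Fin 3) (Fin 3) L) (T : GL (Fin 3) ℂ)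
      (hT : (T : Matrix (Fin 3) (Fin 3) ℂ)ᴴ * H.map ι * (T : Matrix (Fin 3) (Fin 3) ℂ) = Literature.Geometry.ComplexHyperbolic.BallModel.J)
      (hdef : ∀ τ' : L →+* ℂ, InfinitePlace.mk τ' ≠ InfinitePlace.mk ι → (H.map τ').PosDef) (h2 : 2 ≤ Module.finrank ℚ ↥(maximalRealSubfield L))
      (μ : Measure (Gp L H).automorphicQuotient) [(Gp L H).IsAutomorphicMeasure μ] (μω : HeckeCharacter L) (hμu : μω.IsUnitary)
      (hμω : ∀ x : Literature.NumberTheory.GaloisRepresentations.ideleGroup ↥(maximalRealSubfield L),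
        μω (AdeleRing.ideleBaseChange (↥(maximalRealSubfield L)) L x) = quadraticHeckeCharCM L x),
      ∃ S₀ : Finset (Places L), F0P3InnerFormClassificationV8.ClassificationKit.Laws (kitFamilyOfRecord 𝔇 L ι H T hT hdef h2 μ μω hμu hμω) μω hμu S₀) :
    F0P3InnerFormClassificationV8.KitFamily.Laws (kitFamilyOfRecord 𝔇) :=
  hL

/-- **THE HJ3a LINE'S LETTERS FROM THE v8 LAWS AT THE FAMILY OF RECORD** — `m(P) ≤ 1` on the cotangent locus at every compact CM frame, and E2′ `hodgeTypeRigid`: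
★ B0 `letters_of_guardedEngine` ∘ ★ V8-D `shapeGuarded_of_T5` (same guarded conclusion text as v4–v6) at `kitFamilyOfRecord 𝔇`, pinned by ★ `isPinned_kitFamilyOfRecord`
(v8 adds no pin). [cite: Rogawski1990, §14.6 Thm. 14.6.4; §15.3 ¶1; Prop. 15.2.1 (b)] [cite: BorelWallach2000, VI Thm. 4.11] -/
theorem letters_of_kitFamilyOfRecordV8
    (𝔇 : ∀ (L : Type) [Field L] [NumberField L] [IsCMField L] (ι : L →+* ℂ) (H : Matrix (Fin 3) (Fin 3) L) (T : GL (Fin 3) ℂ)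
      (hT : (T : Matrix (Fin 3) (Fin 3) ℂ)ᴴ * H.map ι * (T : Matrix (Fin 3) (Fin 3) ℂ) = Literature.Geometry.ComplexHyperbolic.BallModel.J),
      (∀ τ' : L →+* ℂ, InfinitePlace.mk τ' ≠ InfinitePlace.mk ι → (H.map τ').PosDef) →
      2 ≤ Module.finrank ℚ ↥(maximalRealSubfield L) →
      ∀ (μ : Measure (Gp L H).automorphicQuotient) [(Gp L H).IsAutomorphicMeasure μ] (μω : HeckeCharacter L) (_hμu : μω.IsUnitary),
      (∀ x : Literature.NumberTheory.GaloisRepresentations.ideleGroup ↥(maximalRealSubfield L),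
        μω (AdeleRing.ideleBaseChange (↥(maximalRealSubfield L)) L x) = quadraticHeckeCharCM L x) → FrameData L H ι T hT μ)
    (hlaws : F0P3InnerFormClassificationV8.KitFamily.Laws (kitFamilyOfRecord 𝔇)) :
    (∀ (L : Type) [Field L] [NumberField L] [IsCMField L] (ι : L →+* ℂ) (H : Matrix (Fin 3) (Fin 3) L) (T : GL (Fin 3) ℂ)
      (hT : (T : Matrix (Fin 3) (Fin 3) ℂ)ᴴ * H.map ι * (T : Matrix (Fin 3) (Fin 3) ℂ) = Literature.Geometry.ComplexHyperbolic.BallModel.J),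
      (∀ τ' : L →+* ℂ, InfinitePlace.mk τ' ≠ InfinitePlace.mk ι → (H.map τ').PosDef) →
      2 ≤ Module.finrank ℚ ↥(maximalRealSubfield L) →
      ∀ (μ : Measure (adelicGroupData (↥(maximalRealSubfield L)) L (IsCMField.complexConj L) 3 H).automorphicQuotient)
        [(adelicGroupData (↥(maximalRealSubfield L)) L (IsCMField.complexConj L) 3 H).IsAutomorphicMeasure μ]
        (P : DiscreteAutomorphicRep (adelicGroupData (↥(maximalRealSubfield L)) L (IsCMField.complexConj L) 3 H) μ),
        (P.IsHolCotangentAt (cmArchSection L ι H T hT) (cmCompactFactor L ι H T hT) ∨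
          P.IsAntiholCotangentAt (cmArchSection L ι H T hT) (cmCompactFactor L ι H T hT)) →
        ((adelicGroupData (↥(maximalRealSubfield L)) L (IsCMField.complexConj L) 3 H).rightRegular μ).multiplicity
            P.space.toContRep ≤ 1) ∧
    Literature.NumberTheory.Rogawski1990.hodgeTypeRigid :=
  letters_of_guardedEngine (F0P3InnerFormClassificationV8.shapeGuarded_of_T5 (kitFamilyOfRecord 𝔇) (isPinned_kitFamilyOfRecord 𝔇) hlaws)

end Family

/-! ## §4 K9α at v8 — the letters from `SpecPkg` + the remaining NAMED rows (fourteen conjuncts) -/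

/-- **K9α AT v8 — `letters_of_specPkgV8`** (= ★ `letters_of_specPkg` re-based on the BOOKS PASS, RULINGS (V43)(V44)): for a family `𝔇` of per-frame external data, IF at every
letters' frame the kit of record satisfies the witnessed package `SpecPkg` and the NAMED rows #1 (T1's head), TF, #2, #6, #7, #8 (L2-SA), #10, #15 (L3′, v6 text), the arch
clauses, and the ξ-rows #20 #21 #23 — FOURTEEN conjuncts at ONE level `S₀` per frame, no `FlathDet`, no «AFA» — THEN the HJ3a line's two letters hold (`letters_of_kitFamilyOfRecordV8` ∘
`laws₈_kitOfRecord_of₄`). [cite: Rogawski1990, §14.6 Thm. 14.6.4 pp. 236–244; §15.3 ¶1; Prop. 15.2.1 (b)] [cite: BorelWallach2000, VI Thm. 4.11] -/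
theorem letters_of_specPkgV8
    (𝔇 : ∀ (L : Type) [Field L] [NumberField L] [IsCMField L] (ι : L →+* ℂ) (H : Matrix (Fin 3) (Fin 3) L) (T : GL (Fin 3) ℂ)
      (hT : (T : Matrix (Fin 3) (Fin 3) ℂ)ᴴ * H.map ι * (T : Matrix (Fin 3) (Fin 3) ℂ) = Literature.Geometry.ComplexHyperbolic.BallModel.J),
      (∀ τ' : L →+* ℂ, InfinitePlace.mk τ' ≠ InfinitePlace.mk ι → (H.map τ').PosDef) →
      2 ≤ Module.finrank ℚ ↥(maximalRealSubfield L) →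
      ∀ (μ : Measure (Gp L H).automorphicQuotient) [(Gp L H).IsAutomorphicMeasure μ] (μω : HeckeCharacter L) (_hμu : μω.IsUnitary),
      (∀ x : Literature.NumberTheory.GaloisRepresentations.ideleGroup ↥(maximalRealSubfield L),
        μω (AdeleRing.ideleBaseChange (↥(maximalRealSubfield L)) L x) = quadraticHeckeCharCM L x) → FrameData L H ι T hT μ)
    (h : ∀ (L : Type) [Field L] [NumberField L] [IsCMField L] (ι : L →+* ℂ) (H : Matrix (Fin 3) (Fin 3) L) (T : GL (Fin 3) ℂ)
      (hT : (T : Matrix (Fin 3) (Fin 3) ℂ)ᴴ * H.map ι * (T : Matrix (Fin 3) (Fin 3) ℂ) = Literature.Geometry.ComplexHyperbolic.BallModel.J)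
      (hdef : ∀ τ' : L →+* ℂ, InfinitePlace.mk τ' ≠ InfinitePlace.mk ι → (H.map τ').PosDef) (h2 : 2 ≤ Module.finrank ℚ ↥(maximalRealSubfield L))
      (μ : Measure (Gp L H).automorphicQuotient) [(Gp L H).IsAutomorphicMeasure μ] (μω : HeckeCharacter L) (hμu : μω.IsUnitary)
      (hμω : ∀ x : Literature.NumberTheory.GaloisRepresentations.ideleGroup ↥(maximalRealSubfield L),
        μω (AdeleRing.ideleBaseChange (↥(maximalRealSubfield L)) L x) = quadraticHeckeCharCM L x),
      -- ONE level `S₀` per frame (v8, RULING (V44)); the witnessed package at `S₀` (K9β: `Classical.choose_spec`, unioned by `.mono`)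
      ∃ S₀ : Finset (Places L),
      F0P3InnerFormClassificationV8.ClassificationKit.SpecPkg (kitFamilyOfRecord 𝔇 L ι H T hT hdef h2 μ μω hμu hμω) S₀ ∧
      -- #1 (T1's head at the overridden kit, K9β §A), TF (class factorisation), #2, #6, #7, #8, #10, #15 (v6 text, UNGUARDED — ★ p823358)
      (kitFamilyOfRecord 𝔇 L ι H T hT hdef h2 μ μω hμu hμω).TraceIdentity ∧
      F0P3InnerFormClassificationV8.ClassificationKit.FactorisationCls (kitFamilyOfRecord 𝔇 L ι H T hT hdef h2 μ μω hμu hμω) S₀ ∧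
      (kitFamilyOfRecord 𝔇 L ι H T hT hdef h2 μ μω hμu hμω).SpectralSideGp ∧
      F0P3InnerFormClassificationV8.ClassificationKit.HatBounded (kitFamilyOfRecord 𝔇 L ι H T hT hdef h2 μ μω hμu hμω) S₀ ∧
      F0P3InnerFormClassificationV8.ClassificationKit.UnrStarAlgebra (kitFamilyOfRecord 𝔇 L ι H T hT hdef h2 μ μω hμu hμω) S₀ ∧
      (kitFamilyOfRecord 𝔇 L ι H T hT hdef h2 μ μω hμu hμω).LinIndepS ∧
      F0P3InnerFormClassificationV8.ClassificationKit.UnitaryPacket (kitFamilyOfRecord 𝔇 L ι H T hT hdef h2 μ μω hμu hμω) S₀ ∧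
      (kitFamilyOfRecord 𝔇 L ι H T hT hdef h2 μ μω hμu hμω).Routing ∧
      -- the arch clauses on the family's `jInf dsInf` (R-22′) and the ξ-rows #20 #21 #23 (no #12 `FlathDet`, no «AFA»: RULINGS (V43)(V44))
      JInfNoDegOne (𝔇 L ι H T hT hdef h2 μ μω hμu hμω).jInf ∧ DsInfNoDegOne (𝔇 L ι H T hT hdef h2 μ μω hμu hμω).dsInf ∧
      (kitFamilyOfRecord 𝔇 L ι H T hT hdef h2 μ μω hμu hμω).XiFamilyFin μω hμu ∧
      (kitFamilyOfRecord 𝔇 L ι H T hT hdef h2 μ μω hμu hμω).XiUnram ∧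
      (kitFamilyOfRecord 𝔇 L ι H T hT hdef h2 μ μω hμu hμω).EvpConvention) :
    (∀ (L : Type) [Field L] [NumberField L] [IsCMField L] (ι : L →+* ℂ) (H : Matrix (Fin 3) (Fin 3) L) (T : GL (Fin 3) ℂ)
      (hT : (T : Matrix (Fin 3) (Fin 3) ℂ)ᴴ * H.map ι * (T : Matrix (Fin 3) (Fin 3) ℂ) = Literature.Geometry.ComplexHyperbolic.BallModel.J),
      (∀ τ' : L →+* ℂ, InfinitePlace.mk τ' ≠ InfinitePlace.mk ι → (H.map τ').PosDef) →
      2 ≤ Module.finrank ℚ ↥(maximalRealSubfield L) →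
      ∀ (μ : Measure (adelicGroupData (↥(maximalRealSubfield L)) L (IsCMField.complexConj L) 3 H).automorphicQuotient)
        [(adelicGroupData (↥(maximalRealSubfield L)) L (IsCMField.complexConj L) 3 H).IsAutomorphicMeasure μ]
        (P : DiscreteAutomorphicRep (adelicGroupData (↥(maximalRealSubfield L)) L (IsCMField.complexConj L) 3 H) μ),
        (P.IsHolCotangentAt (cmArchSection L ι H T hT) (cmCompactFactor L ι H T hT) ∨
          P.IsAntiholCotangentAt (cmArchSection L ι H T hT) (cmCompactFactor L ι H T hT)) →
        ((adelicGroupData (↥(maximalRealSubfield L)) L (IsCMField.complexConj L) 3 H).rightRegular μ).multiplicity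
            P.space.toContRep ≤ 1) ∧
    Literature.NumberTheory.Rogawski1990.hodgeTypeRigid := by
  refine letters_of_kitFamilyOfRecordV8 𝔇 fun L _ _ _ ι H T hT hdef h2 μ _ μω hμu hμω => ?_
  obtain ⟨S₀, hpk, h1, hTF, h2', h6, h7, h8, h10, h15, hJ, hD, h20, h21, h23⟩ := h L ι H T hT hdef h2 μ μω hμu hμω
  letI : MeasurableSpace (Gp L H).Adelic := borel _
  haveI : BorelSpace (Gp L H).Adelic := ⟨rfl⟩
  haveI := (𝔇 L ι H T hT hdef h2 μ μω hμu hμω).isFiniteMeasureOnCompacts_ν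
  exact ⟨S₀, laws₈_kitOfRecord_of₄ L H ι T hT μ _ _ _ μω hμu _ _ _ _ _ _ _ S₀ hdef h2 h1 h2'
    (F0P3InnerFormClassificationV8.ClassificationKit.factorisation_of_cls_of_pk _ hTF hpk.factorisationPk) hpk.matchingS hpk.transferS h6 h7 h8 h10
    hpk.aPacketSpectral hpk.localExpansion (routing₈_kitOfRecord_of_v6 L H ι T hT μ _ _ _ μω _ _ _ _ _ _ _ h15) hμω hJ hD h20 h21 h23⟩

end Summit.HodgeConjecture.HodgeConjecture.Cruxes.H413.F0P3KitOfRecord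

end
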